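import Mathlib
import Summits.Ventures.HodgeRepro.Tier4.Line1.RTFSetting
import Summits.Ventures.HodgeRepro.Tier4.Line1.HeckeIsolation
import Summits.Ventures.HodgeRepro.Tier4.Line1.HeckeRankOneOfBlock
import Summits.Ventures.HodgeRepro.Tier4.Line1.HeckeIsolationHecke
import Summits.Ventures.HodgeRepro.Tier4.Line1.HeckeBlockWeak
import Summits.Ventures.HodgeRepro.Tier4.Line1.HeckeBlockSpherical

/-!
# Tier4/Line1/HeckeIsolationSpherical — (S3″) from a family of WEAK blocks, and end to end in the spherical case
(the composition t4-crit-2 g4 asked for, S13952 Entry 86)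

Blind re-derivation cell `pub-hodge-repro`, Tier 4 (README §9–§10), seat t4-L1-p5 (prover, LINE L1, gen 3).  Target tree
path `lean/Summits/Ventures/HodgeRepro/Tier4/Line1/HeckeIsolationSpherical.lean`.  Imports this seat's `HeckeIsolationHecke`
(p685508: `RealisedHecke`, `isolationRealised_of_heckeBlock` — over STRONG blocks), `HeckeBlockWeak` (p685856:
`HeckeBlockW`, `HeckeBlockW.exists_isolatedAt_hecke`), `HeckeBlockSpherical` (p686211: `sphericalBlock`,
`HeckeBlockW.spherical`, `finiteDimensional_sphericalBlock`).

WHAT THIS IS.  `isolationRealised_of_heckeBlock` (p685508) takes one STRONG `HeckeBlock` per constituent, while the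
spherical instance `HeckeBlockW.spherical` (p686211) is a WEAK block and `HeckeBlock.toW` goes the other way — so the
assembly and the instance did not compose in the tree (t4-crit-2 g4, S13952).  Here:
* `isolationRealised_of_heckeBlockW`: (S3″) `IsolationRealised` from a family of WEAK blocks, and the family is asked
  ONLY at the constituents carrying both toric periods (`D : ∀ m, PeriodNonzeroT → PeriodNonzeroT' → HeckeBlockW …`
  — a constituent without admissible vectors has no block and is never asked for one);
* `SphericalData`: the per-constituent data of the spherical instance (the index set of the block's constituents,
  the constituent submodules `W i = τ (idx i) ∩ sphericalBlock S K`, their `H`-linear projections, (C1), (C2)) in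
  one structure, `SphericalData.toHeckeBlockW` = `HeckeBlockW.spherical`;
* `isolationRealised_spherical`: (S3″) END TO END IN THE SPHERICAL CASE — for a compact open `K`, from the common
  Hecke algebra `H` acting on `sphericalBlock S K` by right-`K`-invariant test functions (`hact`, the convolution law),
  per-constituent `SphericalData` at the constituents carrying both periods ((C1), (C2), the projections), the density
  clauses on the spherical admissible vectors and the dictionary `RealisedHecke`: the level idempotent's four identities
  and fact (A) are kernel facts here (p686211, p684555), so the row reads «kernel end to end modulo (C1), (C2),
  convolution law + projections, density, dictionary».
Nothing of (C1), (C2), the convolution law, the projections, the density clauses or the dictionary is proved.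
Nothing here says anything about the status of the Hodge conjecture for CM abelian varieties, which is NOT proved
(HC_CM is NOT proved by anyone in this repository).
-/

set_option autoImplicit false

noncomputable section

namespace Summit.Ventures.HodgeRepro.Tier4.Line1

open MeasureTheory Topology NumberField Common PeriodCloser

section Weak

variable {Form : Type} [AddCommGroup Form] [Module ℂ Form] {A : FormAlgebra Form} {W : Witness A}
  {G : Type} [Group G] [TopologicalSpace G] [IsTopologicalGroup G] [MeasurableSpace G] [BorelSpace G]
  (S : RTF.Setting G) (χ : S.T → ℂ) (χ' : S.T' → ℂ) (τ : ℕ → Set (G → ℂ)) (Lift : ℕ → Prop)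
  (φ : ℕ → G → ℂ) (n : ℕ → ℕ) (tf : W.Translates → (G → ℂ) × (G → ℂ)) (H : Type) (tst : H → (G → ℂ))

omit [IsTopologicalGroup G] in
/-- **(S3″) from a family of WEAK Hecke blocks**, asked only at the constituents carrying both toric periods:
`IsolationRealised` from `HeckeBlockW` at those constituents (common Hecke algebra `H`, common `tst`), the
admissible-density clauses on the blocks and the dictionary clause `RealisedHecke`.  `Lift` is not used. -/
theorem isolationRealised_of_heckeBlockW [Countable S.Gk] [MeasurableMul G] [Ring H] [Algebra ℂ H]
    (hB : S.IsAdaptedONB τ φ n) (ι : ℕ → Type) [∀ m, Fintype (ι m)] [∀ m, DecidableEq (ι m)]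
    (Vb : ℕ → Submodule ℂ (G → ℂ)) [∀ m, FiniteDimensional ℂ (Vb m)] [∀ m, Module H (Vb m)]
    [∀ m, IsScalarTower ℂ H (Vb m)]
    (D : ∀ m, S.PeriodNonzeroT χ (τ m) → S.PeriodNonzeroT' χ' (τ m) →
      RTF.Setting.HeckeBlockW S τ m H (ι m) (Vb m))
    (htst : ∀ m hT hT', (D m hT hT').tst = tst)
    (hPA : ∀ m, S.PeriodNonzeroT χ (τ m) →
      ∃ w ∈ RTF.Setting.blockAdmissible τ m (Vb m), S.periodT χ (fun t => w t) ≠ 0)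
    (hPA' : ∀ m, S.PeriodNonzeroT' χ' (τ m) →
      ∃ w' ∈ RTF.Setting.blockAdmissible τ m (Vb m), S.periodT' χ' (fun t' => w' t') ≠ 0)
    (hreal : RealisedHecke S χ χ' φ n tf H tst) : IsolationRealised S χ χ' τ Lift φ n tf := by
  intro m hT hT' _
  obtain ⟨r, r', hiso⟩ := (D m hT hT').exists_isolatedAt_hecke hB (hPA m hT) (hPA' m hT')
  rw [htst m hT hT'] at hiso
  exact hreal m r r' hiso

end Weak

namespace RTF.Setting

variable {G : Type} [Group G] [TopologicalSpace G] [IsTopologicalGroup G] [MeasurableSpace G] [BorelSpace G]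
  (S : Setting G) (K : Subgroup G)

/-- **the per-constituent data of the spherical block** (everything `HeckeBlockW.spherical` takes beyond the common
Hecke algebra): the index set of the block's constituents, `τ m`'s index, the constituent submodules
`W i = τ (idx i) ∩ sphericalBlock S K`, their `H`-linear projections, (C1) simplicity, (C2) pairwise
non-isomorphism.  Every field is a HYPOTHESIS; nothing is constructed here. -/
structure SphericalData (τ : ℕ → Set (G → ℂ)) (m : ℕ) (H : Type) [Ring H] [Algebra ℂ H] (ι : Type) [Fintype ι]
    [DecidableEq ι] [Module H (sphericalBlock S K)] [IsScalarTower ℂ H (sphericalBlock S K)] where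
  /-- the constituents of the block, by index -/
  idx : ι → ℕ
  /-- the index of `τ m` -/
  i₀ : ι
  /-- `τ m` is the `i₀`-th constituent -/
  hi₀ : idx i₀ = m
  /-- the constituents as `H`-submodules of the block -/
  W : ι → Submodule H (sphericalBlock S K)
  /-- `W i = τ (idx i) ∩ sphericalBlock S K` -/
  hW : ∀ (i : ι) (ψ : sphericalBlock S K), ψ ∈ W i ↔ (ψ : G → ℂ) ∈ τ (idx i)
  /-- the `H`-linear projections onto the constituents -/
  π : ι → sphericalBlock S K →ₗ[H] sphericalBlock S K
  /-- `π i` lands in `W i` -/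
  hπmem : ∀ i v, π i v ∈ W i
  /-- the projections sum to the identity -/
  hπsum : ∀ v, ∑ i, π i v = v
  /-- `π i` is the identity on `W i` -/
  hπid : ∀ i, ∀ w ∈ W i, π i w = w
  /-- `π i` kills `W j` for `j ≠ i` -/
  hπzero : ∀ i j, i ≠ j → ∀ w ∈ W j, π i w = 0
  /-- (C1): every constituent of the block is a simple `H`-module -/
  [simple : ∀ i, IsSimpleModule H (W i)]
  /-- (C2): the constituents are pairwise non-isomorphic `H`-modules -/
  hnon : ∀ i j, i ≠ j → IsEmpty ((W i) ≃ₗ[H] (W j))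

variable {S K}

/-- the spherical weak block of a `SphericalData` (= `HeckeBlockW.spherical`). -/
def SphericalData.toHeckeBlockW {τ : ℕ → Set (G → ℂ)} {m : ℕ} {H : Type} [Ring H] [Algebra ℂ H] {ι : Type}
    [Fintype ι] [DecidableEq ι] [Module H (sphericalBlock S K)] [IsScalarTower ℂ H (sphericalBlock S K)]
    (hKo : IsOpen (K : Set G)) (hKc : IsCompact (K : Set G)) [SecondCountableTopology G] [MeasurableMul G]
    [SFinite S.μ] (hinv : ∀ m', S.IsInvariantSubspace (τ m')) [FiniteDimensional ℂ (sphericalBlock S K)]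
    (tst : H → (G → ℂ)) (htst : ∀ r, IsTest (tst r)) (htstK : ∀ r y, ∀ k ∈ K, tst r (y * k) = tst r y)
    (hact : ∀ (r : H) (ψ : sphericalBlock S K), ((r • ψ : sphericalBlock S K) : G → ℂ) = S.R (tst r) ψ)
    (D : SphericalData S K τ m H ι) : HeckeBlockW S τ m H ι (sphericalBlock S K) :=
  haveI := D.simple
  HeckeBlockW.spherical τ m hKo hKc hinv H ι tst htst htstK hact D.idx D.i₀ D.hi₀ D.W D.hW D.π D.hπmem D.hπsum
    D.hπid D.hπzero D.hnon

/-- the test-function map of the spherical weak block is the given one. -/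
theorem SphericalData.toHeckeBlockW_tst {τ : ℕ → Set (G → ℂ)} {m : ℕ} {H : Type} [Ring H] [Algebra ℂ H] {ι : Type}
    [Fintype ι] [DecidableEq ι] [Module H (sphericalBlock S K)] [IsScalarTower ℂ H (sphericalBlock S K)]
    (hKo : IsOpen (K : Set G)) (hKc : IsCompact (K : Set G)) [SecondCountableTopology G] [MeasurableMul G]
    [SFinite S.μ] (hinv : ∀ m', S.IsInvariantSubspace (τ m')) [FiniteDimensional ℂ (sphericalBlock S K)]
    (tst : H → (G → ℂ)) (htst : ∀ r, IsTest (tst r)) (htstK : ∀ r y, ∀ k ∈ K, tst r (y * k) = tst r y)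
    (hact : ∀ (r : H) (ψ : sphericalBlock S K), ((r • ψ : sphericalBlock S K) : G → ℂ) = S.R (tst r) ψ)
    (D : SphericalData S K τ m H ι) :
    (D.toHeckeBlockW hKo hKc hinv tst htst htstK hact).tst = tst := rfl

end RTF.Setting

section Spherical

variable {Form : Type} [AddCommGroup Form] [Module ℂ Form] {A : FormAlgebra Form} {W : Witness A}
  {G : Type} [Group G] [TopologicalSpace G] [IsTopologicalGroup G] [MeasurableSpace G] [BorelSpace G]
  (S : RTF.Setting G) (χ : S.T → ℂ) (χ' : S.T' → ℂ) (τ : ℕ → Set (G → ℂ)) (Lift : ℕ → Prop)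
  (φ : ℕ → G → ℂ) (n : ℕ → ℕ) (tf : W.Translates → (G → ℂ) × (G → ℂ)) (K : Subgroup G) (H : Type)
  (tst : H → (G → ℂ))

/-- **(S3″) END TO END IN THE SPHERICAL CASE**: for a compact open `K`, `IsolationRealised` from the common Hecke
algebra `H` acting on `sphericalBlock S K` by right-`K`-invariant test functions (`hact`, the convolution law),
per-constituent `SphericalData` at the constituents carrying both toric periods ((C1), (C2), the projections), the
density clauses on the spherical admissible vectors, and the dictionary `RealisedHecke`; the level idempotent's four
identities and fact (A) are kernel facts (p686211, p684555).  `Lift` is not used. -/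
theorem isolationRealised_spherical [Countable S.Gk] [MeasurableMul G] [SecondCountableTopology G] [SFinite S.μ]
    [Ring H] [Algebra ℂ H] [Module H (RTF.Setting.sphericalBlock S K)]
    [IsScalarTower ℂ H (RTF.Setting.sphericalBlock S K)]
    (hB : S.IsAdaptedONB τ φ n) (hKo : IsOpen (K : Set G)) (hKc : IsCompact (K : Set G))
    (htst : ∀ r, RTF.IsTest (tst r)) (htstK : ∀ r y, ∀ k ∈ K, tst r (y * k) = tst r y)
    (hact : ∀ (r : H) (ψ : RTF.Setting.sphericalBlock S K),
      ((r • ψ : RTF.Setting.sphericalBlock S K) : G → ℂ) = S.R (tst r) ψ)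
    (ι : ℕ → Type) [∀ m, Fintype (ι m)] [∀ m, DecidableEq (ι m)]
    (D : ∀ m, S.PeriodNonzeroT χ (τ m) → S.PeriodNonzeroT' χ' (τ m) → RTF.Setting.SphericalData S K τ m H (ι m))
    (hPA : ∀ m, S.PeriodNonzeroT χ (τ m) →
      ∃ w ∈ RTF.Setting.blockAdmissible τ m (RTF.Setting.sphericalBlock S K), S.periodT χ (fun t => w t) ≠ 0)
    (hPA' : ∀ m, S.PeriodNonzeroT' χ' (τ m) →
      ∃ w' ∈ RTF.Setting.blockAdmissible τ m (RTF.Setting.sphericalBlock S K),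
        S.periodT' χ' (fun t' => w' t') ≠ 0)
    (hreal : RealisedHecke S χ χ' φ n tf H tst) : IsolationRealised S χ χ' τ Lift φ n tf := by
  haveI := S.finiteDimensional_sphericalBlock K hKo
  exact isolationRealised_of_heckeBlockW S χ χ' τ Lift φ n tf H tst hB ι (fun _ => RTF.Setting.sphericalBlock S K)
    (fun m hT hT' => (D m hT hT').toHeckeBlockW hKo hKc hB.inv tst htst htstK hact)
    (fun m hT hT' => (D m hT hT').toHeckeBlockW_tst hKo hKc hB.inv tst htst htstK hact) hPA hPA' hreal

end Spherical

end Summit.Ventures.HodgeRepro.Tier4.Line1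

end
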